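import Literature.Probability.Percolation.FiveMarkedLoops
import Literature.Probability.Percolation.TriChordSides
import Literature.Probability.Percolation.TriFaceLabel
import Literature.Probability.Percolation.TriSepProbEstimates
import Mathlib.Combinatorics.SimpleGraph.Acyclic
import Mathlib.Combinatorics.SimpleGraph.DegreeSum
import HarnessLib

/-!
# The five-marked loop lemma, I: locality, disorders, degrees, uniqueness of the link pattern, image

Topic `Literature/Probability/Percolation`; proofs (pcv-sawmu b-engine-2 g5) of the general-domain faces of
`FiveMarkedLoops.lean`, for EVERY `D : TriMarkedDomain 5`:
* `loopLocal_holds` (L1: the link patterns read `σ` only on `G`), `crossFlip_holds`, `loopFlip_holds`, `loop5'_of_loop5`;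
* the `k = 5` boundary layer (twin of the tree's `k = 4` `TriDiscInterface` positions/colours): `posIdx`,
  `stretchIdx_eq_posIdx`, `stretchIdx_markDart = i`, `stretchIdx_predDart = i - 1`, `succ_faceDart`,
  `posIdx_dpos_succ_of_fst_ne`, `stretchIdx_views_eq`, the cell colours `vcol5` with `bicol_side_iff` and `bicolDeg_eq`;
* `loopDegLeTwo_holds` (P′: no face has three bicoloured sides) and `loopParity_holds` (P: the odd faces are exactly the
  corner faces `y_j`, `j ≠ r` — «∂ξ(σ) = {u₁,…,u₄}»);
* `loopUnique_holds` (¬(MatchA ∧ MatchB): the `IStep`-component of `y_{r+1}` is connected of maximum degree 2 and would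
  contain three vertices of degree one — handshake against `#V ≤ #E + 1`);
* `loopImage_holds` (`ξ_{r,c}(σ) ∈ W_Ω(y_{r+1}, …, y_{r+4})`).

## References
* M. Khristoforov, S. Smirnov, *Percolation and O(1) loop model*, arXiv:2111.15612 (2021), §1.2 (Def. 3, Lemma 2, Lemma 4).
* B. Bollobás, O. Riordan, *Percolation*, Cambridge University Press (2006), Ch. 7 §7.2.2 pp. 168–171 (Lemma 5, Fig. 9).
-/

open Finset

namespace Literature.Probability.Percolation.FivePoint

open Literature.Probability.Percolation Literature.Probability.LatticeModels

variable (D : TriMarkedDomain 5)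


/-! ### (L1) locality: every D1-v2 predicate reads `σ` only on the sites of `G` -/

/-- Auxiliary. [folklore] -/
private theorem inter_helper₁ {α : Type*} (σ : Set α) (G : Finset α) (u v : α) (hu : u ∈ G) (hv : v ∈ G) :
    (u ∈ σ ∩ ↑G ↔ v ∉ σ ∩ ↑G) ↔ (u ∈ σ ↔ v ∉ σ) := by
  simp [Set.mem_inter_iff, hu, hv]

/-- Auxiliary. [folklore] -/
private theorem inter_helper₂ {α : Type*} (σ : Set α) (G : Finset α) (u : α) (a : Bool) (hu : u ∈ G) :
    (u ∈ σ ∩ ↑G ↔ a = false) ↔ (u ∈ σ ↔ a = false) := by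
  simp [Set.mem_inter_iff, hu]

/-- `Bicol` reads `σ` only on `D.verts`. [cite: KhristoforovSmirnov2021, §1.2 (loop configurations, pp. 3–4)] -/
theorem bicol_inter_iff (σ : SiteConfig (Site 2)) (r : Fin 5) (c : Bool) (u v : Site 2) :
    Bicol D (σ ∩ ↑D.verts) r c u v ↔ Bicol D σ r c u v := by
  unfold Bicol
  exact or_congr (and_congr_right fun hu => and_congr_right fun hv => inter_helper₁ σ _ u v hu hv)
    (or_congr (and_congr_right fun hu => and_congr_right fun _ => inter_helper₂ σ _ u _ hu)
      (and_congr_right fun hv => and_congr_right fun _ => inter_helper₂ σ _ v _ hv))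

/-- hence `IStep` is the same relation for `σ` and `σ ∩ G`. [cite: KhristoforovSmirnov2021, §1.2 (loop configurations, pp. 3–4)] -/
theorem iStep_inter_eq (σ : SiteConfig (Site 2)) (r : Fin 5) (c : Bool) :
    IStep D (σ ∩ ↑D.verts) r c = IStep D σ r c := by
  funext F F'
  simp only [IStep, bicol_inter_iff]

/-- **(L1) holds for every domain.** [cite: KhristoforovSmirnov2021, §1.2 (loop configurations, pp. 3–4)] -/
theorem loopLocal_holds : LoopLocal D := by
  intro σ r c
  refine ⟨?_, ?_⟩
  · simp only [MatchA, iStep_inter_eq]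
  · simp only [MatchB, iStep_inter_eq]

/-- `InInterface` is local too (for the N5 layer). [cite: KhristoforovSmirnov2021, §1.2 (loop configurations, pp. 3–4)] -/
theorem inInterface_inter_iff (σ : SiteConfig (Site 2)) (r : Fin 5) (c : Bool) (F : HexVertex) :
    InInterface D (σ ∩ ↑D.verts) r c F ↔ InInterface D σ r c F := by
  simp only [InInterface, iStep_inter_eq]

/-- `Joined` is local too (for the N5 layer). [cite: KhristoforovSmirnov2021, §1.2 (loop configurations, pp. 3–4)] -/
theorem joined_inter_iff (σ : SiteConfig (Site 2)) (r : Fin 5) (c : Bool) (x : HexVertex) :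
    Joined D (σ ∩ ↑D.verts) r c x ↔ Joined D σ r c x := by
  simp only [Joined, inInterface_inter_iff]

/-! ### colour flip -/

/-- `IsOpenCrossing σᶜ = IsClosedCrossing σ` and conversely (definitional up to `compl_compl`). [cite: KhristoforovSmirnov2021, §1.2 (loop configurations, pp. 3–4)] -/
theorem crossFlip_holds : CrossFlip D := by
  intro σ i j
  refine ⟨Iff.rfl, ?_⟩
  simp only [TriMarkedDomain.IsClosedCrossing, TriMarkedDomain.IsOpenCrossing, compl_compl]

/-- flipping the super-arc colour flips every outer colour. [cite: KhristoforovSmirnov2021, §1.2 (loop configurations, pp. 3–4)] -/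
theorem arcColour_not (r : Fin 5) (c : Bool) (i : Fin 5) : arcColour r (!c) i = !arcColour r c i := by
  unfold arcColour
  simp only
  split_ifs <;> simp

/-- Auxiliary. [folklore] -/
private theorem compl_helper₁ {α : Type*} (σ : Set α) (u v : α) : (u ∈ σᶜ ↔ v ∉ σᶜ) ↔ (u ∈ σ ↔ v ∉ σ) := by
  simp only [Set.mem_compl_iff, not_not]
  tauto

/-- Auxiliary. [folklore] -/
private theorem compl_helper₂ {α : Type*} (σ : Set α) (u : α) (a : Bool) :
    (u ∈ σᶜ ↔ (!a) = false) ↔ (u ∈ σ ↔ a = false) := by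
  cases a <;> simp

/-- `Bicol` is invariant under complementing the colouring together with the boundary colours. [cite: KhristoforovSmirnov2021, §1.2 (loop configurations, pp. 3–4)] -/
theorem bicol_compl_iff (σ : SiteConfig (Site 2)) (r : Fin 5) (c : Bool) (u v : Site 2) :
    Bicol D σᶜ r (!c) u v ↔ Bicol D σ r c u v := by
  unfold Bicol
  rw [arcColour_not, arcColour_not, compl_helper₁, compl_helper₂, compl_helper₂]

/-- hence `IStep` is flip-invariant. [cite: KhristoforovSmirnov2021, §1.2 (loop configurations, pp. 3–4)] -/
theorem iStep_compl_eq (σ : SiteConfig (Site 2)) (r : Fin 5) (c : Bool) :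
    IStep D σᶜ r (!c) = IStep D σ r c := by
  funext F F'
  simp only [IStep, bicol_compl_iff]

/-- **(flip) holds for every domain.** [cite: KhristoforovSmirnov2021, §1.2 (loop configurations, pp. 3–4)] -/
theorem loopFlip_holds : LoopFlip D := by
  intro σ r c
  refine ⟨?_, ?_⟩
  · simp only [MatchA, iStep_compl_eq]
  · simp only [MatchB, iStep_compl_eq]

/-- so the `c = true` loop lemma follows from the `c = false` one, for every domain. [cite: KhristoforovSmirnov2021, §1.2 (loop configurations, pp. 3–4)] -/
theorem loop5'_of_loop5 (h : FiveMarkedLoopLemma D) : FiveMarkedLoopLemma' D :=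
  loop5'_of D (loopFlip_holds D) (crossFlip_holds D) h

/-! ### Boundary positions and stretches of a 5-marked domain (the `k = 5` twin of the tree's
`TriDiscInterface` §"Positions of boundary darts and the stretch index", which is stated for `k = 4`) -/

/-- `0 = pos 0 < pos 1 < pos 2 < pos 3 < pos 4 < #∂`. [cite: KhristoforovSmirnov2021, §1.2 (loop configurations, pp. 3–4)] -/
theorem pos_facts : D.pos 0 = 0 ∧ D.pos 0 < D.pos 1 ∧ D.pos 1 < D.pos 2 ∧ D.pos 2 < D.pos 3 ∧
    D.pos 3 < D.pos 4 ∧ D.pos 4 < #(triBdryDarts D.verts) :=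
  ⟨D.pos_zero (by norm_num), D.pos_strictMono (by decide), D.pos_strictMono (by decide),
    D.pos_strictMono (by decide), D.pos_strictMono (by decide), D.pos_lt 4⟩

/-- The stretch index of a POSITION: the `i` with `pos i ≤ n % #∂ < nextPos i`. [folklore] -/
noncomputable def posIdx (n : ℕ) : Fin 5 :=
  if n % #(triBdryDarts D.verts) < D.pos 1 then 0
  else if n % #(triBdryDarts D.verts) < D.pos 2 then 1
  else if n % #(triBdryDarts D.verts) < D.pos 3 then 2
  else if n % #(triBdryDarts D.verts) < D.pos 4 then 3 else 4

/-- `nextPos` below the last mark. [cite: KhristoforovSmirnov2021, §1.2 (loop configurations, pp. 3–4)] -/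
theorem nextPos_of_lt (i : Fin 5) (h : i.val + 1 < 5) : D.nextPos i = D.pos ⟨i.val + 1, h⟩ := dif_pos h

/-- `nextPos` of the last mark is the cycle length. [cite: KhristoforovSmirnov2021, §1.2 (loop configurations, pp. 3–4)] -/
theorem nextPos_four : D.nextPos 4 = #(triBdryDarts D.verts) := dif_neg (by decide)

/-- `nextPos i ≤ #∂`. [cite: KhristoforovSmirnov2021, §1.2 (loop configurations, pp. 3–4)] -/
theorem nextPos_le (i : Fin 5) : D.nextPos i ≤ #(triBdryDarts D.verts) := by
  unfold TriMarkedDomain.nextPos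
  split_ifs with h
  · exact (D.pos_lt _).le
  · exact le_rfl

/-- consecutive stretches abut: `nextPos i ≤ pos j` for `i < j`. [cite: KhristoforovSmirnov2021, §1.2 (loop configurations, pp. 3–4)] -/
theorem nextPos_le_pos_of_lt {i j : Fin 5} (h : i < j) : D.nextPos i ≤ D.pos j := by
  have hij : i.val < j.val := h
  have hi : i.val + 1 < 5 := by omega
  rw [nextPos_of_lt D i hi]
  exact D.pos_strictMono.monotone (show (⟨i.val + 1, hi⟩ : Fin 5) ≤ j from Nat.succ_le_of_lt hij)

/-- the stretch of a position contains it. [cite: KhristoforovSmirnov2021, §1.2 (loop configurations, pp. 3–4)] -/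
theorem pos_posIdx_le (n : ℕ) :
    D.pos (posIdx D n) ≤ n % #(triBdryDarts D.verts) ∧
      n % #(triBdryDarts D.verts) < D.nextPos (posIdx D n) := by
  obtain ⟨hz, h01, h12, h23, h34, h4⟩ := pos_facts D
  have hlt := Nat.mod_lt n D.isTriDisc.card_pos
  unfold posIdx
  split_ifs with ha hb hc hd
  · rw [hz, nextPos_of_lt D 0 (by decide)]; exact ⟨Nat.zero_le _, ha⟩
  · rw [nextPos_of_lt D 1 (by decide)]; exact ⟨by omega, hb⟩
  · rw [nextPos_of_lt D 2 (by decide)]; exact ⟨by omega, hc⟩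
  · rw [nextPos_of_lt D 3 (by decide)]; exact ⟨by omega, hd⟩
  · rw [nextPos_four D]; exact ⟨by omega, hlt⟩

/-- the position index only depends on the position modulo `#∂`. [cite: KhristoforovSmirnov2021, §1.2 (loop configurations, pp. 3–4)] -/
theorem posIdx_mod (n : ℕ) : posIdx D (n % #(triBdryDarts D.verts)) = posIdx D n := by
  unfold posIdx; rw [Nat.mod_mod]

/-- **uniqueness**: the stretches' position intervals are disjoint. [cite: KhristoforovSmirnov2021, §1.2 (loop configurations, pp. 3–4)] -/
theorem posIdx_unique {n : ℕ} {i : Fin 5} (h1 : D.pos i ≤ n % #(triBdryDarts D.verts))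
    (h2 : n % #(triBdryDarts D.verts) < D.nextPos i) : posIdx D n = i := by
  obtain ⟨g1, g2⟩ := pos_posIdx_le D n
  by_contra hne
  rcases lt_or_gt_of_ne hne with hlt | hgt
  · have := nextPos_le_pos_of_lt D hlt; omega
  · have := nextPos_le_pos_of_lt D hgt; omega

/-- a dart of the `i`-th stretch is a boundary dart whose position has index `i`. [cite: KhristoforovSmirnov2021, §1.2 (loop configurations, pp. 3–4)] -/
theorem posIdx_dpos_of_mem_stretch {d : Site 2 × Site 2} {i : Fin 5} (h : d ∈ D.stretch i) :
    d ∈ triBdryDarts D.verts ∧ posIdx D (D.dpos d) = i := by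
  obtain ⟨m, hm, rfl⟩ := Finset.mem_image.1 h
  obtain ⟨hm1, hm2⟩ := Finset.mem_Ico.1 hm
  have hmL : m < #(triBdryDarts D.verts) := lt_of_lt_of_le hm2 (nextPos_le D i)
  refine ⟨triBdryIter_mem D.base_mem m, ?_⟩
  rw [D.dpos_eq_of_iter_eq hmL rfl]
  exact posIdx_unique D (by rwa [Nat.mod_eq_of_lt hmL]) (by rwa [Nat.mod_eq_of_lt hmL])

/-- the dart at position `n` lies in the stretch of index `posIdx n`. [cite: KhristoforovSmirnov2021, §1.2 (loop configurations, pp. 3–4)] -/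
theorem iter_mem_stretch_posIdx (n : ℕ) : triBdryIter D.verts D.base n ∈ D.stretch (posIdx D n) := by
  obtain ⟨h1, h2⟩ := pos_posIdx_le D n
  refine Finset.mem_image.2 ⟨n % #(triBdryDarts D.verts), Finset.mem_Ico.2 ⟨h1, h2⟩, ?_⟩
  exact D.isTriDisc.iter_mod n

/-- every boundary dart lies in the stretch of its position's index. [cite: KhristoforovSmirnov2021, §1.2 (loop configurations, pp. 3–4)] -/
theorem mem_stretch_posIdx {d : Site 2 × Site 2} (hd : d ∈ triBdryDarts D.verts) :
    d ∈ D.stretch (posIdx D (D.dpos d)) := by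
  have := iter_mem_stretch_posIdx D (D.dpos d)
  rwa [D.iter_dpos hd] at this

/-- **the D1-v2 dart-based `stretchIdx` is the position index**, for boundary darts. [cite: KhristoforovSmirnov2021, §1.2 (loop configurations, pp. 3–4)] -/
theorem stretchIdx_eq_posIdx {d : Site 2 × Site 2} (hd : d ∈ triBdryDarts D.verts) :
    stretchIdx D d = posIdx D (D.dpos d) := by
  unfold stretchIdx
  have hne : (Finset.univ.filter fun i : Fin 5 => d ∈ D.stretch i).Nonempty :=
    ⟨_, Finset.mem_filter.2 ⟨Finset.mem_univ _, mem_stretch_posIdx D hd⟩⟩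
  rw [dif_pos hne]
  have hmem := Finset.min'_mem _ hne
  exact ((posIdx_dpos_of_mem_stretch D (Finset.mem_filter.1 hmem).2).2).symm

/-- consecutive positions are in the same stretch unless the second is a mark. [cite: KhristoforovSmirnov2021, §1.2 (loop configurations, pp. 3–4)] -/
theorem posIdx_succ_eq {n : ℕ} (h : ∀ i : Fin 5, (n + 1) % #(triBdryDarts D.verts) ≠ D.pos i) :
    posIdx D (n + 1) = posIdx D n := by
  obtain ⟨hz, h01, h12, h23, h34, h4⟩ := pos_facts D
  have hL := D.isTriDisc.card_pos
  have h0 := h 0; have h1 := h 1; have h2 := h 2; have h3 := h 3; have h4' := h 4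
  rw [hz] at h0
  have hsucc := TriMarkedDomain.succ_mod_eq (n := n) hL h0
  unfold posIdx
  rw [hsucc] at h1 h2 h3 h4' ⊢
  split_ifs <;> first | rfl | omega

/-- `nextPos (i - 1) = pos i` for `i ≠ 0`. [cite: KhristoforovSmirnov2021, §1.2 (loop configurations, pp. 3–4)] -/
theorem nextPos_sub_one {i : Fin 5} (hi : i ≠ 0) : D.nextPos (i - 1) = D.pos i := by
  fin_cases i
  · exact absurd rfl hi
  · show D.nextPos 0 = D.pos 1; rw [nextPos_of_lt D 0 (by decide)]; rfl
  · show D.nextPos 1 = D.pos 2; rw [nextPos_of_lt D 1 (by decide)]; rfl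
  · show D.nextPos 2 = D.pos 3; rw [nextPos_of_lt D 2 (by decide)]; rfl
  · show D.nextPos 3 = D.pos 4; rw [nextPos_of_lt D 3 (by decide)]; rfl

/-- `pos (i - 1) < pos i` for `i ≠ 0`. [cite: KhristoforovSmirnov2021, §1.2 (loop configurations, pp. 3–4)] -/
theorem pos_sub_one_lt {i : Fin 5} (hi : i ≠ 0) : D.pos (i - 1) < D.pos i := by
  rw [← nextPos_sub_one D hi]; exact D.pos_lt_nextPos _

/-- **at the `i`-th mark the index becomes `i`, from `i - 1`.** [cite: KhristoforovSmirnov2021, §1.2 (loop configurations, pp. 3–4)] -/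
theorem posIdx_of_succ_mod_eq_pos {n : ℕ} {i : Fin 5}
    (h : (n + 1) % #(triBdryDarts D.verts) = D.pos i) :
    posIdx D (n + 1) = i ∧ posIdx D n = i - 1 := by
  obtain ⟨hz, h01, h12, h23, h34, h4⟩ := pos_facts D
  have hL := D.isTriDisc.card_pos
  have hlt := Nat.mod_lt n hL
  constructor
  · exact posIdx_unique D (by rw [h]) (by rw [h]; exact D.pos_lt_nextPos i)
  · by_cases hi : i = 0
    · subst hi
      rw [hz] at h
      have hn : n % #(triBdryDarts D.verts) = #(triBdryDarts D.verts) - 1 := by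
        by_contra hne
        have := TriMarkedDomain.succ_mod_eq (n := n) hL (by
          intro h0
          have : n % #(triBdryDarts D.verts) + 1 = #(triBdryDarts D.verts) ∨
              n % #(triBdryDarts D.verts) + 1 < #(triBdryDarts D.verts) := by omega
          rcases this with h' | h'
          · exact hne (by omega)
          · rw [Nat.add_mod, Nat.one_mod_eq_one.2 (by omega), Nat.mod_eq_of_lt h'] at h0
            omega)
        omega
      refine posIdx_unique D ?_ ?_
      · show D.pos 4 ≤ _; omega
      · show _ < D.nextPos 4; rw [nextPos_four D]; omega
    · have hpos : 0 < D.pos i := by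
        have : D.pos 0 < D.pos i := D.pos_strictMono (Fin.pos_iff_ne_zero.2 hi)
        omega
      have hn : n % #(triBdryDarts D.verts) = D.pos i - 1 := by
        have := TriMarkedDomain.succ_mod_eq (n := n) hL (by rw [h]; exact hpos.ne')
        omega
      have hlt' := pos_sub_one_lt D hi
      refine posIdx_unique D ?_ ?_
      · -- `pos (i-1) ≤ pos i - 1`
        omega
      · rw [nextPos_sub_one D hi]; omega

/-- if position `n + 1` is the `i`-th mark then the dart there is the marked dart … [cite: KhristoforovSmirnov2021, §1.2 (loop configurations, pp. 3–4)] -/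
theorem iter_succ_eq_markDart {n : ℕ} {i : Fin 5} (h : (n + 1) % #(triBdryDarts D.verts) = D.pos i) :
    triBdryIter D.verts D.base (n + 1) = D.markDart i := by
  unfold TriMarkedDomain.markDart
  rw [D.isTriDisc.iter_eq_iter_iff, h, Nat.mod_eq_of_lt (D.pos_lt i)]

/-- … and the dart at position `n` is its predecessor `predDart i`. [cite: KhristoforovSmirnov2021, §1.2 (loop configurations, pp. 3–4)] -/
theorem iter_eq_predDart {n : ℕ} {i : Fin 5} (h : (n + 1) % #(triBdryDarts D.verts) = D.pos i) :
    triBdryIter D.verts D.base n = predDart D i := by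
  have hL := D.isTriDisc.card_pos
  have e1 : triBdryIter D.verts D.base (D.pos i + (#(triBdryDarts D.verts) - 1)) =
      triBdryIter D.verts D.base n := by
    rw [D.isTriDisc.iter_eq_iter_iff]
    have e : (n + 1 + (#(triBdryDarts D.verts) - 1)) % #(triBdryDarts D.verts) =
        n % #(triBdryDarts D.verts) := by
      rw [show n + 1 + (#(triBdryDarts D.verts) - 1) = n + #(triBdryDarts D.verts) by omega,
        Nat.add_mod_right]
    rw [← e, Nat.add_mod (n + 1), h, Nat.add_mod (D.pos i), Nat.mod_add_mod]
  exact e1.symm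

/-- the marked dart is a boundary dart. [cite: KhristoforovSmirnov2021, §1.2 (loop configurations, pp. 3–4)] -/
theorem markDart_mem (i : Fin 5) : D.markDart i ∈ triBdryDarts D.verts := triBdryIter_mem D.base_mem _

/-- its predecessor is a boundary dart. [cite: KhristoforovSmirnov2021, §1.2 (loop configurations, pp. 3–4)] -/
theorem predDart_mem (i : Fin 5) : predDart D i ∈ triBdryDarts D.verts := triBdryIter_mem D.base_mem _

/-- the marked site lies in `G`. [cite: KhristoforovSmirnov2021, §1.2 (loop configurations, pp. 3–4)] -/
theorem markSite_mem (i : Fin 5) : D.markSite i ∈ D.verts := (mem_triBdryDarts.1 (markDart_mem D i)).1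

/-- the head of the marked dart lies outside `G`. [cite: KhristoforovSmirnov2021, §1.2 (loop configurations, pp. 3–4)] -/
theorem markDart_snd_not_mem (i : Fin 5) : (D.markDart i).2 ∉ D.verts := (mem_triBdryDarts.1 (markDart_mem D i)).2.1

/-- the head of the predecessor dart lies outside `G`. [cite: KhristoforovSmirnov2021, §1.2 (loop configurations, pp. 3–4)] -/
theorem predDart_snd_not_mem (i : Fin 5) : (predDart D i).2 ∉ D.verts := (mem_triBdryDarts.1 (predDart_mem D i)).2.1

/-- the predecessor has the same tail `v_i` (`mark_pred`). [cite: KhristoforovSmirnov2021, §1.2 (loop configurations, pp. 3–4)] -/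
theorem predDart_fst (i : Fin 5) : (predDart D i).1 = D.markSite i := D.mark_pred i

/-- the successor of the predecessor is the marked dart. [cite: KhristoforovSmirnov2021, §1.2 (loop configurations, pp. 3–4)] -/
theorem succ_predDart (i : Fin 5) : triBdrySucc D.verts (predDart D i) = D.markDart i := by
  unfold predDart TriMarkedDomain.markDart TriMarkedDomain.bdryLen
  rw [← triBdryIter_succ, show D.pos i + (#(triBdryDarts D.verts) - 1) + 1 = D.pos i + #(triBdryDarts D.verts) by
    have := D.isTriDisc.card_pos; omega, D.isTriDisc.iter_add_card]

/-- the position of the marked dart. [cite: KhristoforovSmirnov2021, §1.2 (loop configurations, pp. 3–4)] -/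
theorem dpos_markDart (i : Fin 5) : D.dpos (D.markDart i) = D.pos i := D.dpos_eq_of_iter_eq (D.pos_lt i) rfl

/-- the position after the predecessor is the mark. [cite: KhristoforovSmirnov2021, §1.2 (loop configurations, pp. 3–4)] -/
theorem dpos_predDart_succ (i : Fin 5) : (D.dpos (predDart D i) + 1) % #(triBdryDarts D.verts) = D.pos i := by
  have h := D.dpos_succ (predDart_mem D i)
  rw [succ_predDart, dpos_markDart] at h
  exact h.symm

/-- the marked dart has stretch index `i` … [cite: KhristoforovSmirnov2021, §1.2 (loop configurations, pp. 3–4)] -/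
theorem stretchIdx_markDart (i : Fin 5) : stretchIdx D (D.markDart i) = i := by
  rw [stretchIdx_eq_posIdx D (markDart_mem D i), dpos_markDart]
  exact posIdx_unique D (by rw [Nat.mod_eq_of_lt (D.pos_lt i)])
    (by rw [Nat.mod_eq_of_lt (D.pos_lt i)]; exact D.pos_lt_nextPos i)

/-- … and its predecessor has stretch index `i - 1`. [cite: KhristoforovSmirnov2021, §1.2 (loop configurations, pp. 3–4)] -/
theorem stretchIdx_predDart (i : Fin 5) : stretchIdx D (predDart D i) = i - 1 := by
  rw [stretchIdx_eq_posIdx D (predDart_mem D i)]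
  exact (posIdx_of_succ_mod_eq_pos D (dpos_predDart_succ D i)).2

/-! ### Boundary darts around a face -/

/-- the successor of an anticlockwise dart of a face with outside head, for any site set `G`: around the head if the
third vertex is inside, around the tail otherwise (the tree's `TriMarkedDomain.succ_faceDart` is the `k = 4` domain case). [cite: KhristoforovSmirnov2021, §1.2 (loop configurations, pp. 3–4)] -/
theorem succ_faceDart₅ (G : Finset (Site 2)) {F : HexVertex} {j : Fin 3} :
    triBdrySucc G (faceVertex F j, faceVertex F (j + 1)) =
      if faceVertex F (j + 2) ∈ G then (faceVertex F (j + 2), faceVertex F (j + 1))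
      else (faceVertex F j, faceVertex F (j + 2)) := by
  simp only [triBdrySucc, triLeftApex_faceVertex]

/-- an anticlockwise dart of a face with tail inside and head outside a site set `G` is a boundary dart of `G`. [cite: KhristoforovSmirnov2021, §1.2 (loop configurations, pp. 3–4)] -/
theorem faceDart_mem₅ {G : Finset (Site 2)} {F : HexVertex} {j : Fin 3} (hj : faceVertex F j ∈ G)
    (hj1 : faceVertex F (j + 1) ∉ G) :
    (faceVertex F j, faceVertex F (j + 1)) ∈ triBdryDarts G :=
  mem_triBdryDarts.2 ⟨hj, hj1, by rw [faceVertex_succ]; exact triGraph_adj_add_triDir _ _⟩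

/-- a clockwise dart of a face with tail inside and head outside a site set `G` is a boundary dart of `G`. [cite: KhristoforovSmirnov2021, §1.2 (loop configurations, pp. 3–4)] -/
theorem faceDart_mem₅' {G : Finset (Site 2)} {F : HexVertex} {j : Fin 3} (hj1 : faceVertex F (j + 1) ∈ G)
    (hj : faceVertex F j ∉ G) :
    (faceVertex F (j + 1), faceVertex F j) ∈ triBdryDarts G :=
  mem_triBdryDarts.2 ⟨hj1, hj, by rw [faceVertex_succ]; exact (triGraph_adj_add_triDir _ _).symm⟩

/-- **consecutive boundary darts with different tails are in the same stretch** (a mark is preceded by a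
dart with the same tail). [cite: KhristoforovSmirnov2021, §1.2 (loop configurations, pp. 3–4)] -/
theorem posIdx_dpos_succ_of_fst_ne {d : Site 2 × Site 2} (hd : d ∈ triBdryDarts D.verts)
    (hne : (triBdrySucc D.verts d).1 ≠ d.1) :
    posIdx D (D.dpos (triBdrySucc D.verts d)) = posIdx D (D.dpos d) := by
  rw [D.dpos_succ hd, posIdx_mod]
  apply posIdx_succ_eq
  intro i hi
  have h1 := iter_eq_predDart D hi
  have h2 := iter_succ_eq_markDart D hi
  rw [D.iter_dpos hd] at h1
  rw [triBdryIter_succ, D.iter_dpos hd] at h2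
  apply hne
  rw [h2, h1, predDart_fst]
  rfl

/-- **consistency of the two views of an outside vertex** whose two neighbours in the face are inside. [cite: KhristoforovSmirnov2021, §1.2 (loop configurations, pp. 3–4)] -/
theorem stretchIdx_views_eq {F : HexVertex} {j : Fin 3} (hj : faceVertex F j ∉ D.verts)
    (hj1 : faceVertex F (j + 1) ∈ D.verts) (hj2 : faceVertex F (j + 2) ∈ D.verts) :
    stretchIdx D (faceVertex F (j + 2), faceVertex F j) = stretchIdx D (faceVertex F (j + 1), faceVertex F j) := by
  have e3 : j + 2 + 1 = j := by rw [add_assoc]; exact add_eq_left.2 (by decide)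
  have e4 : j + 2 + 2 = j + 1 := by rw [add_assoc]; congr 1
  have hd : (faceVertex F (j + 2), faceVertex F j) ∈ triBdryDarts D.verts := by
    have := faceDart_mem₅ (j := j + 2) hj2 (by rw [e3]; exact hj)
    rwa [e3] at this
  have hsucc : triBdrySucc D.verts (faceVertex F (j + 2), faceVertex F j) =
      (faceVertex F (j + 1), faceVertex F j) := by
    have := succ_faceDart₅ D.verts (F := F) (j := j + 2)
    rw [e3, e4] at this
    rw [this, if_pos hj1]
  have hd' : (faceVertex F (j + 1), faceVertex F j) ∈ triBdryDarts D.verts := hsucc ▸ triBdrySucc_mem hd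
  have := posIdx_dpos_succ_of_fst_ne D hd (by
    rw [hsucc]
    intro e
    exact absurd (add_left_cancel (faceVertex_injective F e)) (by decide))
  rw [hsucc] at this
  rw [stretchIdx_eq_posIdx D hd, stretchIdx_eq_posIdx D hd', this]

/-! ### Colours of the cells around a face, and the bicoloured sides -/

/-- **the colour of the `v`-th vertex of the face `F` as seen inside `F`** under `(σ, r, c)`: the state of the
site if it is in `G`, else the outer colour beyond the boundary dart into it from the next vertex of the face
(if that one is in `G`) or from the one after. (The `k = 5`, `arcColour` twin of the tree's `TriMarkedDomain.vcol`.) [folklore] -/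
noncomputable def vcol5 (σ : SiteConfig (Site 2)) (r : Fin 5) (c : Bool) (F : HexVertex) (v : Fin 3) : Bool := by
  classical
  exact if faceVertex F v ∈ D.verts then decide (faceVertex F v ∈ σ)
    else if faceVertex F (v + 1) ∈ D.verts then arcColour r c (stretchIdx D (faceVertex F (v + 1), faceVertex F v))
    else arcColour r c (stretchIdx D (faceVertex F (v + 2), faceVertex F v))

/-- the `j`-th side of `F` (from the `(j+1)`-st to the `(j+2)`-nd vertex) has an endpoint in `G`. [cite: KhristoforovSmirnov2021, §1.2 (loop configurations, pp. 3–4)] -/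
def HasG5 (F : HexVertex) (j : Fin 3) : Prop :=
  faceVertex F (j + 1) ∈ D.verts ∨ faceVertex F (j + 2) ∈ D.verts

/-- Auxiliary. [folklore] -/
private theorem decide_ne_decide_iff (P Q : Prop) [Decidable P] [Decidable Q] :
    decide P ≠ decide Q ↔ (P ↔ ¬Q) := by
  by_cases hP : P <;> by_cases hQ : Q <;> simp [hP, hQ]

/-- Auxiliary. [folklore] -/
private theorem decide_ne_iff (P : Prop) [Decidable P] (a : Bool) : decide P ≠ a ↔ (P ↔ a = false) := by
  cases a <;> by_cases hP : P <;> simp [hP]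

/-- Auxiliary. [folklore] -/
private theorem ne_decide_iff (P : Prop) [Decidable P] (a : Bool) : a ≠ decide P ↔ (P ↔ a = false) := by
  cases a <;> by_cases hP : P <;> simp [hP]

/-- **a side with an endpoint in `G` is bicoloured iff the two cell colours seen inside the face differ.** [cite: KhristoforovSmirnov2021, §1.2 (loop configurations, pp. 3–4)] -/
theorem bicol_side_iff (σ : SiteConfig (Site 2)) (r : Fin 5) (c : Bool) {F : HexVertex} {j : Fin 3}
    (hG : HasG5 D F j) :
    Bicol D σ r c (faceVertex F (j + 1)) (faceVertex F (j + 2)) ↔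
      vcol5 D σ r c F (j + 1) ≠ vcol5 D σ r c F (j + 2) := by
  classical
  have e2 : j + 1 + 1 = j + 2 := by rw [add_assoc]; rfl
  have e3 : j + 1 + 2 = j := by rw [add_assoc]; exact add_eq_left.2 (by decide)
  have e4 : j + 2 + 1 = j := by rw [add_assoc]; exact add_eq_left.2 (by decide)
  have e5 : j + 2 + 2 = j + 1 := by rw [add_assoc]; congr 1
  unfold Bicol vcol5
  by_cases h1 : faceVertex F (j + 1) ∈ D.verts <;> by_cases h2 : faceVertex F (j + 2) ∈ D.verts
  · -- both inside
    rw [if_pos h1, if_pos h2, decide_ne_decide_iff]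
    constructor
    · rintro (⟨-, -, h⟩ | ⟨-, h, -⟩ | ⟨-, h, -⟩)
      · exact h
      · exact absurd h2 h
      · exact absurd h1 h
    · intro h; exact Or.inl ⟨h1, h2, h⟩
  · -- `x_{j+1}` inside, `x_{j+2}` outside
    rw [if_pos h1, if_neg h2, e4, e5, decide_ne_iff]
    have hview : (if faceVertex F j ∈ D.verts then arcColour r c (stretchIdx D (faceVertex F j, faceVertex F (j + 2)))
        else arcColour r c (stretchIdx D (faceVertex F (j + 1), faceVertex F (j + 2)))) =
        arcColour r c (stretchIdx D (faceVertex F (j + 1), faceVertex F (j + 2))) := by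
      split_ifs with h0
      · have := stretchIdx_views_eq D (j := j + 2) h2 (by rw [e4]; exact h0) (by rw [e5]; exact h1)
        rw [e4, e5] at this
        rw [this]
      · rfl
    rw [hview]
    constructor
    · rintro (⟨-, h, -⟩ | ⟨-, -, h⟩ | ⟨h, -, -⟩)
      · exact absurd h h2
      · exact h
      · exact absurd h h2
    · intro h; exact Or.inr (Or.inl ⟨h1, h2, h⟩)
  · -- `x_{j+1}` outside, `x_{j+2}` inside
    rw [if_neg h1, if_pos h2, e2, if_pos h2, ne_decide_iff]
    constructor
    · rintro (⟨h, -, -⟩ | ⟨h, -, -⟩ | ⟨-, -, h⟩)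
      · exact absurd h h1
      · exact absurd h h1
      · exact h
    · intro h; exact Or.inr (Or.inr ⟨h2, h1, h⟩)
  · exact absurd hG (by rintro (h | h); exacts [h1 h, h2 h])

/-- a side with no endpoint in `G` is not bicoloured (it is not an edge of `H_G`). [cite: KhristoforovSmirnov2021, §1.2 (loop configurations, pp. 3–4)] -/
theorem not_bicol_side (σ : SiteConfig (Site 2)) (r : Fin 5) (c : Bool) {F : HexVertex} {j : Fin 3}
    (hG : ¬ HasG5 D F j) : ¬ Bicol D σ r c (faceVertex F (j + 1)) (faceVertex F (j + 2)) := by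
  rintro (⟨h, -, -⟩ | ⟨h, -, -⟩ | ⟨h, -, -⟩)
  · exact hG (Or.inl h)
  · exact hG (Or.inl h)
  · exact hG (Or.inr h)

open Classical in
/-- **the `ξ`-degree of a face = the number of its `H_G`-sides whose end colours differ.** [cite: KhristoforovSmirnov2021, §1.2 (loop configurations, pp. 3–4)] -/
theorem bicolDeg_eq (σ : SiteConfig (Site 2)) (r : Fin 5) (c : Bool) (F : HexVertex) :
    bicolDeg D σ r c F = #((Finset.univ : Finset (Fin 3)).filter fun j =>
      HasG5 D F j ∧ vcol5 D σ r c F (j + 1) ≠ vcol5 D σ r c F (j + 2)) := by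
  unfold bicolDeg
  congr 1
  refine Finset.filter_congr fun j _ => ?_
  by_cases hG : HasG5 D F j
  · rw [bicol_side_iff D σ r c hG]; exact (and_iff_right hG).symm
  · exact ⟨fun h => absurd h (not_bicol_side D σ r c hG), fun h => absurd h.1 hG⟩

/-- three Booleans around a triangle: at most two unequal adjacent pairs. [folklore] -/
private theorem card_filter_succ_ne_le_two (b : Fin 3 → Bool) :
    #((Finset.univ : Finset (Fin 3)).filter fun j => b (j + 1) ≠ b (j + 2)) ≤ 2 := by
  revert b; decide

/-- **(P′) holds for every domain**: no face has three bicoloured sides. [cite: KhristoforovSmirnov2021, §1.2 (loop configurations, pp. 3–4)] -/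
theorem loopDegLeTwo_holds : LoopDegLeTwo D := by
  classical
  intro σ r c F
  rw [bicolDeg_eq]
  refine le_trans (Finset.card_le_card ?_) (card_filter_succ_ne_le_two (vcol5 D σ r c F))
  intro j
  simp only [Finset.mem_filter, Finset.mem_univ, true_and]
  exact fun h => h.2

/-! ### (P) the odd faces are exactly the four colour-change corner faces -/

/-- Auxiliary. [folklore] -/
private theorem fin3_cases (v j : Fin 3) : j = v ∨ j = v + 1 ∨ j = v + 2 := by
  revert v j; decide

/-- Auxiliary. [folklore] -/
private theorem fin3_univ_eq (v : Fin 3) : (Finset.univ : Finset (Fin 3)) = {v, v + 1, v + 2} := by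
  revert v; decide

/-- the vertices of a face, listed from any starting vertex. [cite: KhristoforovSmirnov2021, §1.2 (loop configurations, pp. 3–4)] -/
theorem hexFaceVertices_eq_triple (F : HexVertex) (v : Fin 3) :
    hexFaceVertices F = {faceVertex F v, faceVertex F (v + 1), faceVertex F (v + 2)} := by
  rw [hexFaceVertices_eq_image_faceVertex, fin3_univ_eq v, Finset.image_insert, Finset.image_insert,
    Finset.image_singleton]

/-- three Booleans around a triangle: an even number of unequal adjacent pairs. [folklore] -/
private theorem card_filter_succ_ne_mod_two (b : Fin 3 → Bool) :
    #((Finset.univ : Finset (Fin 3)).filter fun j => b (j + 1) ≠ b (j + 2)) % 2 = 0 := by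
  revert b; decide

/-- dropping the side opposite `v`: the two remaining unequal-pair indicators have odd sum iff the two far
colours differ. [folklore] -/
private theorem card_filter_ne_and_mod_two (v : Fin 3) (b : Fin 3 → Bool) :
    #((Finset.univ : Finset (Fin 3)).filter fun j => j ≠ v ∧ b (j + 1) ≠ b (j + 2)) % 2 = 1 ↔
      b (v + 1) ≠ b (v + 2) := by
  revert v b; decide

/-- the colour does not change at the reference corner and changes at the four others. [cite: KhristoforovSmirnov2021, §1.2 (loop configurations, pp. 3–4)] -/
theorem arcColour_sub_one_ne_iff (c : Bool) {r i : Fin 5} : arcColour r c (i - 1) ≠ arcColour r c i ↔ i ≠ r := by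
  revert r i c; decide

/-- a **type-II face at `v`**: the vertex `x_v` in `G`, the other two outside. Its side views. [cite: KhristoforovSmirnov2021, §1.2 (loop configurations, pp. 3–4)] -/
theorem vcol5_typeII_succ (σ : SiteConfig (Site 2)) (r : Fin 5) (c : Bool) {F : HexVertex} {v : Fin 3}
    (hv1 : faceVertex F (v + 1) ∉ D.verts) (hv2 : faceVertex F (v + 2) ∉ D.verts) :
    vcol5 D σ r c F (v + 1) = arcColour r c (stretchIdx D (faceVertex F v, faceVertex F (v + 1))) := by
  have e2 : v + 1 + 1 = v + 2 := by rw [add_assoc]; rfl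
  have e3 : v + 1 + 2 = v := by rw [add_assoc]; exact add_eq_left.2 (by decide)
  unfold vcol5
  rw [if_neg hv1, e2, if_neg hv2, e3]

/-- (second side view of a type-II face). [cite: KhristoforovSmirnov2021, §1.2 (loop configurations, pp. 3–4)] -/
theorem vcol5_typeII_succ_succ (σ : SiteConfig (Site 2)) (r : Fin 5) (c : Bool) {F : HexVertex} {v : Fin 3}
    (hv : faceVertex F v ∈ D.verts) (hv2 : faceVertex F (v + 2) ∉ D.verts) :
    vcol5 D σ r c F (v + 2) = arcColour r c (stretchIdx D (faceVertex F v, faceVertex F (v + 2))) := by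
  have e4 : v + 2 + 1 = v := by rw [add_assoc]; exact add_eq_left.2 (by decide)
  unfold vcol5
  rw [if_neg hv2, e4, if_pos hv]

/-- at a type-II face the sides with an endpoint in `G` are the two at `x_v`. [cite: KhristoforovSmirnov2021, §1.2 (loop configurations, pp. 3–4)] -/
theorem hasG5_iff_of_typeII {F : HexVertex} {v : Fin 3} (hv : faceVertex F v ∈ D.verts)
    (hv1 : faceVertex F (v + 1) ∉ D.verts) (hv2 : faceVertex F (v + 2) ∉ D.verts) (j : Fin 3) :
    HasG5 D F j ↔ j ≠ v := by
  have e2 : v + 1 + 1 = v + 2 := by rw [add_assoc]; rfl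
  have e3 : v + 1 + 2 = v := by rw [add_assoc]; exact add_eq_left.2 (by decide)
  have e4 : v + 2 + 1 = v := by rw [add_assoc]; exact add_eq_left.2 (by decide)
  unfold HasG5
  rcases fin3_cases v j with rfl | rfl | rfl
  · simp only [ne_eq, not_true_eq_false, iff_false, not_or]; exact ⟨hv1, hv2⟩
  · rw [e2, e3]
    exact ⟨fun _ h => absurd (add_eq_left.1 h) (by decide), fun _ => Or.inr hv⟩
  · rw [e4]
    exact ⟨fun _ h => absurd (add_eq_left.1 h) (by decide), fun _ => Or.inl hv⟩

/-- **parity at a type-II face**: odd iff the outer colours beyond the two boundary darts out of `x_v` differ. [cite: KhristoforovSmirnov2021, §1.2 (loop configurations, pp. 3–4)] -/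
theorem odd_bicolDeg_iff_of_typeII (σ : SiteConfig (Site 2)) (r : Fin 5) (c : Bool) {F : HexVertex} {v : Fin 3}
    (hv : faceVertex F v ∈ D.verts) (hv1 : faceVertex F (v + 1) ∉ D.verts) (hv2 : faceVertex F (v + 2) ∉ D.verts) :
    Odd (bicolDeg D σ r c F) ↔
      arcColour r c (stretchIdx D (faceVertex F v, faceVertex F (v + 1))) ≠
        arcColour r c (stretchIdx D (faceVertex F v, faceVertex F (v + 2))) := by
  classical
  rw [bicolDeg_eq]
  have key : #((Finset.univ : Finset (Fin 3)).filter fun j =>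
      HasG5 D F j ∧ vcol5 D σ r c F (j + 1) ≠ vcol5 D σ r c F (j + 2)) =
      #((Finset.univ : Finset (Fin 3)).filter fun j => j ≠ v ∧ vcol5 D σ r c F (j + 1) ≠ vcol5 D σ r c F (j + 2)) := by
    congr 1
    exact Finset.filter_congr fun j _ => and_congr_left' (hasG5_iff_of_typeII D hv hv1 hv2 j)
  rw [key, Nat.odd_iff, card_filter_ne_and_mod_two v (vcol5 D σ r c F), vcol5_typeII_succ D σ r c hv1 hv2,
    vcol5_typeII_succ_succ D σ r c hv hv2]

/-- a corner face is a type-II face at the marked site, its two outer vertices being the heads of the marked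
dart and of its predecessor (in one of the two orders). [cite: KhristoforovSmirnov2021, §1.2 (loop configurations, pp. 3–4)] -/
theorem isCornerFace_typeII {i : Fin 5} {F : HexVertex} (h : IsCornerFace D i F) :
    ∃ v : Fin 3, faceVertex F v = D.markSite i ∧ faceVertex F (v + 1) ∉ D.verts ∧ faceVertex F (v + 2) ∉ D.verts ∧
      ((faceVertex F (v + 1) = (predDart D i).2 ∧ faceVertex F (v + 2) = (D.markDart i).2) ∨
        (faceVertex F (v + 1) = (D.markDart i).2 ∧ faceVertex F (v + 2) = (predDart D i).2)) := by
  unfold IsCornerFace at h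
  have hm : D.markSite i ∈ hexFaceVertices F := by rw [h]; simp
  obtain ⟨v, hv⟩ := mem_hexFaceVertices_iff_faceVertex.1 hm
  have hmem : ∀ w : Fin 3, faceVertex F w = D.markSite i ∨ faceVertex F w = (D.markDart i).2 ∨
      faceVertex F w = (predDart D i).2 := by
    intro w
    have := faceVertex_mem F w
    rw [h] at this
    simpa only [Finset.mem_insert, Finset.mem_singleton] using this
  have hne1 : faceVertex F (v + 1) ≠ D.markSite i := by
    rw [hv]; intro e; exact absurd (add_eq_left.1 (faceVertex_injective F e)) (by decide)
  have hne2 : faceVertex F (v + 2) ≠ D.markSite i := by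
    rw [hv]; intro e; exact absurd (add_eq_left.1 (faceVertex_injective F e)) (by decide)
  have hne12 : faceVertex F (v + 1) ≠ faceVertex F (v + 2) := by
    intro e; exact absurd (add_left_cancel (faceVertex_injective F e)) (by decide)
  have ho := markDart_snd_not_mem D i
  have ho' := predDart_snd_not_mem D i
  refine ⟨v, hv.symm, ?_, ?_, ?_⟩
  · rcases hmem (v + 1) with e | e | e
    · exact absurd e hne1
    · rw [e]; exact ho
    · rw [e]; exact ho'
  · rcases hmem (v + 2) with e | e | e
    · exact absurd e hne2
    · rw [e]; exact ho
    · rw [e]; exact ho'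
  · rcases hmem (v + 1) with e1 | e1 | e1
    · exact absurd e1 hne1
    · rcases hmem (v + 2) with e2 | e2 | e2
      · exact absurd e2 hne2
      · exact absurd (e1.trans e2.symm) hne12
      · exact Or.inr ⟨e1, e2⟩
    · rcases hmem (v + 2) with e2 | e2 | e2
      · exact absurd e2 hne2
      · exact Or.inl ⟨e1, e2⟩
      · exact absurd (e1.trans e2.symm) hne12

/-- **(P) holds for every domain**: the faces of odd `ξ`-degree are exactly the corner faces of the four
colour-change marks `j ≠ r`. [cite: KhristoforovSmirnov2021, §1.2 (loop configurations, pp. 3–4)] -/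
theorem loopParity_holds : LoopParity D := by
  classical
  intro σ r c F
  by_cases hII : ∃ v : Fin 3, faceVertex F v ∈ D.verts ∧ faceVertex F (v + 1) ∉ D.verts ∧ faceVertex F (v + 2) ∉ D.verts
  · -- a type-II face at `v`
    obtain ⟨v, hv, hv1, hv2⟩ := hII
    rw [odd_bicolDeg_iff_of_typeII D σ r c hv hv1 hv2]
    have hd₁ : (faceVertex F v, faceVertex F (v + 1)) ∈ triBdryDarts D.verts := faceDart_mem₅ hv hv1
    have hsucc : triBdrySucc D.verts (faceVertex F v, faceVertex F (v + 1)) = (faceVertex F v, faceVertex F (v + 2)) := by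
      rw [succ_faceDart₅, if_neg hv2]
    have hd₂ : (faceVertex F v, faceVertex F (v + 2)) ∈ triBdryDarts D.verts := hsucc ▸ triBdrySucc_mem hd₁
    constructor
    · intro hne
      -- the indices differ, so the second dart is a marked dart
      obtain ⟨i, hi⟩ : ∃ i : Fin 5, (D.dpos (faceVertex F v, faceVertex F (v + 1)) + 1) % #(triBdryDarts D.verts) = D.pos i := by
        by_contra hno
        push Not at hno
        apply hne
        rw [stretchIdx_eq_posIdx D hd₁, stretchIdx_eq_posIdx D hd₂, ← hsucc, D.dpos_succ hd₁, posIdx_mod,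
          posIdx_succ_eq D hno]
      have h2 : (faceVertex F v, faceVertex F (v + 2)) = D.markDart i := by
        have := iter_succ_eq_markDart D hi
        rwa [triBdryIter_succ, D.iter_dpos hd₁, hsucc] at this
      have h1 : (faceVertex F v, faceVertex F (v + 1)) = predDart D i := by
        have := iter_eq_predDart D hi
        rwa [D.iter_dpos hd₁] at this
      refine ⟨i, ?_, ?_⟩
      · rw [h1, h2, stretchIdx_predDart, stretchIdx_markDart] at hne
        exact (arcColour_sub_one_ne_iff c).1 hne
      · unfold IsCornerFace
        have em : D.markSite i = faceVertex F v := (congrArg Prod.fst h2).symm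
        have eo : (D.markDart i).2 = faceVertex F (v + 2) := (congrArg Prod.snd h2).symm
        have eo' : (predDart D i).2 = faceVertex F (v + 1) := (congrArg Prod.snd h1).symm
        rw [hexFaceVertices_eq_triple F v, em, eo, eo', Finset.pair_comm]
    · rintro ⟨i, hir, hcorner⟩
      obtain ⟨w, hw, hw1, hw2, hor⟩ := isCornerFace_typeII D hcorner
      have hwv : w = v := by
        rcases fin3_cases v w with e | e | e
        · exact e
        · exact absurd (e ▸ hw ▸ markSite_mem D i) hv1
        · exact absurd (e ▸ hw ▸ markSite_mem D i) hv2
      subst hwv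
      rcases hor with ⟨e1, e2⟩ | ⟨e1, e2⟩
      · have hp : (faceVertex F w, faceVertex F (w + 1)) = predDart D i :=
          Prod.ext (by rw [predDart_fst, hw]) e1
        have hm : (faceVertex F w, faceVertex F (w + 2)) = D.markDart i := Prod.ext hw e2
        rw [hp, hm, stretchIdx_predDart, stretchIdx_markDart]
        exact (arcColour_sub_one_ne_iff c).2 hir
      · have hm : (faceVertex F w, faceVertex F (w + 1)) = D.markDart i := Prod.ext hw e1
        have hp : (faceVertex F w, faceVertex F (w + 2)) = predDart D i :=
          Prod.ext (by rw [predDart_fst, hw]) e2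
        rw [hp, hm, stretchIdx_predDart, stretchIdx_markDart]
        exact ((arcColour_sub_one_ne_iff c).2 hir).symm
  · -- no type-II vertex: even degree, and not a corner face
    push Not at hII
    constructor
    · intro hodd
      exfalso
      rw [bicolDeg_eq] at hodd
      by_cases h0 : ∃ v : Fin 3, faceVertex F v ∈ D.verts
      · obtain ⟨v, hv⟩ := h0
        have hall : ∀ j : Fin 3, HasG5 D F j := by
          intro j
          by_contra hno
          have h1 : faceVertex F (j + 1) ∉ D.verts := fun h => hno (Or.inl h)
          have h2 : faceVertex F (j + 2) ∉ D.verts := fun h => hno (Or.inr h)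
          have h0 : faceVertex F j ∉ D.verts := fun h => h2 (hII j h h1)
          rcases fin3_cases j v with e | e | e
          · exact h0 (e ▸ hv)
          · exact h1 (e ▸ hv)
          · exact h2 (e ▸ hv)
        have key : #((Finset.univ : Finset (Fin 3)).filter fun j =>
            HasG5 D F j ∧ vcol5 D σ r c F (j + 1) ≠ vcol5 D σ r c F (j + 2)) =
            #((Finset.univ : Finset (Fin 3)).filter fun j => vcol5 D σ r c F (j + 1) ≠ vcol5 D σ r c F (j + 2)) := by
          congr 1
          exact Finset.filter_congr fun j _ => and_iff_right (hall j)
        rw [key, Nat.odd_iff, card_filter_succ_ne_mod_two (vcol5 D σ r c F)] at hodd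
        exact absurd hodd (by decide)
      · push Not at h0
        have key : ((Finset.univ : Finset (Fin 3)).filter fun j =>
            HasG5 D F j ∧ vcol5 D σ r c F (j + 1) ≠ vcol5 D σ r c F (j + 2)) = ∅ := by
          refine Finset.filter_eq_empty_iff.2 fun j _ h => ?_
          rcases h.1 with h' | h'
          · exact h0 _ h'
          · exact h0 _ h'
        rw [key, Finset.card_empty] at hodd
        exact absurd hodd (by decide)
    · rintro ⟨i, -, hcorner⟩
      obtain ⟨w, hw, hw1, hw2, -⟩ := isCornerFace_typeII D hcorner
      exact absurd (hII w (hw ▸ markSite_mem D i) hw1) hw2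

/-! ### LoopUnique: the interface component of a corner is a path (handshake on a max-degree-2 component) -/

/-- a corner face is determined by its mark (a face is determined by its vertices, tree `hexFaceVertices_injective`). [cite: KhristoforovSmirnov2021, §1.2 (loop configurations, pp. 3–4)] -/
theorem cornerFace_unique {i : Fin 5} {Y Y' : HexVertex} (h : IsCornerFace D i Y) (h' : IsCornerFace D i Y') : Y = Y' :=
  hexFaceVertices_injective (h.trans h'.symm)

/-- distinct marks have distinct corner faces. [cite: KhristoforovSmirnov2021, §1.2 (loop configurations, pp. 3–4)] -/
theorem cornerFace_idx_unique {i j : Fin 5} {Y : HexVertex} (h : IsCornerFace D i Y) (h' : IsCornerFace D j Y) : i = j := by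
  obtain ⟨v, hv, hv1, hv2, -⟩ := isCornerFace_typeII D h
  obtain ⟨w, hw, hw1, hw2, -⟩ := isCornerFace_typeII D h'
  have hwv : w = v := by
    rcases fin3_cases v w with e | e | e
    · exact e
    · exact absurd (e ▸ hw ▸ markSite_mem D j) hv1
    · exact absurd (e ▸ hw ▸ markSite_mem D j) hv2
  subst hwv
  exact D.mark_injective (show (triBdryIter D.verts D.base (D.pos i)).1 = (triBdryIter D.verts D.base (D.pos j)).1 from
    hv.symm.trans hw)

/-- a corner face touches `G`. [cite: KhristoforovSmirnov2021, §1.2 (loop configurations, pp. 3–4)] -/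
theorem cornerFace_mem_touching {i : Fin 5} {Y : HexVertex} (h : IsCornerFace D i Y) : Y ∈ triFacesTouching D.verts := by
  rw [mem_triFacesTouching]
  refine ⟨D.markSite i, markSite_mem D i, ?_⟩
  unfold IsCornerFace at h
  rw [h]; simp

/-- `Bicol` is symmetric. [cite: KhristoforovSmirnov2021, §1.2 (loop configurations, pp. 3–4)] -/
theorem bicol_comm (σ : SiteConfig (Site 2)) (r : Fin 5) (c : Bool) (u v : Site 2) :
    Bicol D σ r c u v ↔ Bicol D σ r c v u := by
  unfold Bicol
  constructor
  · rintro (⟨h1, h2, h3⟩ | ⟨h1, h2, h3⟩ | ⟨h1, h2, h3⟩)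
    · exact Or.inl ⟨h2, h1, iff_not_comm.1 h3⟩
    · exact Or.inr (Or.inr ⟨h1, h2, h3⟩)
    · exact Or.inr (Or.inl ⟨h1, h2, h3⟩)
  · rintro (⟨h1, h2, h3⟩ | ⟨h1, h2, h3⟩ | ⟨h1, h2, h3⟩)
    · exact Or.inl ⟨h2, h1, iff_not_comm.1 h3⟩
    · exact Or.inr (Or.inr ⟨h1, h2, h3⟩)
    · exact Or.inr (Or.inl ⟨h1, h2, h3⟩)

/-- a face with a bicoloured side touches `G` (the side is an edge of `H_G`). [cite: KhristoforovSmirnov2021, §1.2 (loop configurations, pp. 3–4)] -/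
theorem iStep_fst_mem_touching {σ : SiteConfig (Site 2)} {r : Fin 5} {c : Bool} {F F' : HexVertex}
    (h : IStep D σ r c F F') : F ∈ triFacesTouching D.verts := by
  obtain ⟨-, u, v, he, hb⟩ := h
  have hu : u ∈ hexFaceVertices F := Finset.inter_subset_left (s₂ := hexFaceVertices F') (by rw [show hexFaceVertices F ∩ hexFaceVertices F' = faceEdge F F' from rfl, he]; simp)
  have hv : v ∈ hexFaceVertices F := Finset.inter_subset_left (s₂ := hexFaceVertices F') (by rw [show hexFaceVertices F ∩ hexFaceVertices F' = faceEdge F F' from rfl, he]; simp)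
  rw [mem_triFacesTouching]
  rcases hb with ⟨h1, -, -⟩ | ⟨h1, -, -⟩ | ⟨h1, -, -⟩
  · exact ⟨u, h1, hu⟩
  · exact ⟨u, h1, hu⟩
  · exact ⟨v, h1, hv⟩

/-- the three opposite faces are distinct (the `j`-th vertex lies in the other two but not in the `j`-th). [cite: KhristoforovSmirnov2021, §1.2 (loop configurations, pp. 3–4)] -/
theorem oppFace_injective' (F : HexVertex) : Function.Injective (oppFace F) := by
  intro j j' h
  by_contra hne
  have e3 : j + 1 + 2 = j := by rw [add_assoc]; exact add_eq_left.2 (by decide)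
  have e4 : j + 2 + 1 = j := by rw [add_assoc]; exact add_eq_left.2 (by decide)
  have hnot := faceVertex_not_mem_oppFace F j
  rcases fin3_cases j j' with e | e | e
  · exact hne e.symm
  · subst e
    have := faceVertex_mem (oppFace F (j + 1)) (oppIdx F (j + 1) + 1)
    rw [faceVertex_oppFace_succ, e3, ← h] at this
    exact hnot this
  · subst e
    have := faceVertex_mem (oppFace F (j + 2)) (oppIdx F (j + 2) + 2)
    rw [faceVertex_oppFace_succ_succ, e4, ← h] at this
    exact hnot this

/-- **`IStep` unfolded**: a step to the `j`-th opposite face across a bicoloured side. [cite: KhristoforovSmirnov2021, §1.2 (loop configurations, pp. 3–4)] -/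
theorem iStep_iff (σ : SiteConfig (Site 2)) (r : Fin 5) (c : Bool) (F F' : HexVertex) :
    IStep D σ r c F F' ↔ ∃ j : Fin 3, F' = oppFace F j ∧ Bicol D σ r c (faceVertex F (j + 1)) (faceVertex F (j + 2)) := by
  constructor
  · rintro ⟨hadj, u, v, he, hb⟩
    obtain ⟨j, rfl⟩ := exists_oppFace_eq_of_hexGraph_adj hadj
    refine ⟨j, rfl, ?_⟩
    rw [faceEdge_oppFace] at he
    have he' := congrArg (fun s : Finset (Site 2) => (s : Set (Site 2))) he
    simp only [Finset.coe_insert, Finset.coe_singleton] at he'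
    rcases Set.pair_eq_pair_iff.1 he' with ⟨h1, h2⟩ | ⟨h1, h2⟩
    · rw [h1, h2]; exact hb
    · rw [h1, h2]; exact (bicol_comm D σ r c u v).1 hb
  · rintro ⟨j, rfl, hb⟩
    exact ⟨hexGraph_adj_oppFace F j, faceVertex F (j + 1), faceVertex F (j + 2), faceEdge_oppFace F j, hb⟩

/-- `IStep` is symmetric. [cite: KhristoforovSmirnov2021, §1.2 (loop configurations, pp. 3–4)] -/
theorem iStep_symm {σ : SiteConfig (Site 2)} {r : Fin 5} {c : Bool} {F F' : HexVertex} (h : IStep D σ r c F F') :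
    IStep D σ r c F' F := by
  obtain ⟨hadj, u, v, he, hb⟩ := h
  exact ⟨hadj.symm, u, v, by rw [faceEdge_comm]; exact he, hb⟩

/-- **the loop graph `Ξ_{r,c}(σ)`** on the faces of `𝕋`: adjacency = a bicoloured `H_G`-edge. [folklore] -/
def xiGraph (σ : SiteConfig (Site 2)) (r : Fin 5) (c : Bool) : SimpleGraph HexVertex where
  Adj F F' := IStep D σ r c F F'
  symm := ⟨fun _ _ h => iStep_symm D h⟩
  loopless := ⟨fun _ h => h.1.ne rfl⟩

/-- **LoopUnique holds for every domain**: the interface component of `y_{r+1}` cannot contain both `y_{r+2}`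
and `y_{r+4}` — by (P) the three corners would be three vertices of degree one in a connected graph all of whose
degrees are `≤ 2` (P′), contradicting `Σ deg = 2 #E ≥ 2 (#V - 1)`. [cite: KhristoforovSmirnov2021, §1.2 (loop configurations, pp. 3–4)] -/
theorem loopUnique_holds : LoopUnique D := by
  classical
  intro σ r c hAB
  obtain ⟨⟨Y₁, Y₂, hY₁, hY₂, hA⟩, ⟨Y₁', Y₄, hY₁', hY₄, hB⟩⟩ := hAB
  obtain rfl : Y₁' = Y₁ := cornerFace_unique D hY₁' hY₁
  set C := (xiGraph D σ r c).connectedComponentMk Y₁' with hC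
  have hreach : ∀ F, Relation.ReflTransGen (IStep D σ r c) Y₁' F → F ∈ C.supp := by
    intro F h
    rw [SimpleGraph.ConnectedComponent.mem_supp_iff, hC]
    exact (SimpleGraph.ConnectedComponent.sound ((SimpleGraph.reachable_iff_reflTransGen _ _).2 h)).symm
  have h1 : Y₁' ∈ C.supp := hreach _ Relation.ReflTransGen.refl
  have h2 : Y₂ ∈ C.supp := hreach _ hA
  have h4 : Y₄ ∈ C.supp := hreach _ hB
  -- neighbours stay in the component
  have hsub : ∀ v : C.supp, ∀ w : HexVertex, (xiGraph D σ r c).Adj v w → w ∈ C.supp := by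
    intro v w hw
    have hv := v.2
    rw [SimpleGraph.ConnectedComponent.mem_supp_iff] at hv ⊢
    rw [← hv]
    exact SimpleGraph.ConnectedComponent.sound hw.symm.reachable
  -- the component is finite: every face in it touches `G`
  have hfin : (C.supp).Finite := by
    refine (Finset.finite_toSet (triFacesTouching D.verts)).subset ?_
    intro F hF
    have hF' := (SimpleGraph.ConnectedComponent.mem_supp_iff _ _).1 hF
    rw [hC] at hF'
    obtain ⟨p⟩ := SimpleGraph.ConnectedComponent.exact hF'
    cases p with
    | nil => exact cornerFace_mem_touching D hY₁
    | cons hadj _ => exact iStep_fst_mem_touching D hadj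
  haveI : Fintype C.supp := hfin.fintype
  -- degrees in the component = ξ-degrees
  have hdeg : ∀ v : C.supp, C.toSimpleGraph.degree v = bicolDeg D σ r c v := by
    intro v
    rw [← SimpleGraph.card_neighborFinset_eq_degree]
    unfold bicolDeg
    symm
    refine Finset.card_bij (fun j hj => (⟨oppFace (v : HexVertex) j, hsub v _ ((iStep_iff D σ r c _ _).2
        ⟨j, rfl, (Finset.mem_filter.1 hj).2⟩)⟩ : C.supp)) (fun j hj => ?_) (fun j₁ _ j₂ _ h => ?_) (fun w hw => ?_)
    · rw [SimpleGraph.mem_neighborFinset]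
      exact (iStep_iff D σ r c _ _).2 ⟨j, rfl, (Finset.mem_filter.1 hj).2⟩
    · exact oppFace_injective' _ (congrArg Subtype.val h)
    · rw [SimpleGraph.mem_neighborFinset] at hw
      obtain ⟨j, hj, hb⟩ := (iStep_iff D σ r c _ _).1 hw
      exact ⟨j, Finset.mem_filter.2 ⟨Finset.mem_univ _, hb⟩, Subtype.ext hj.symm⟩
  have hle : ∀ v : C.supp, C.toSimpleGraph.degree v ≤ 2 := fun v => (hdeg v).symm ▸ loopDegLeTwo_holds D σ r c v
  have hone : ∀ v : C.supp, (∃ j : Fin 5, j ≠ r ∧ IsCornerFace D j v) → C.toSimpleGraph.degree v = 1 := by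
    intro v hv
    have hodd := (loopParity_holds D σ r c v).2 hv
    rw [← hdeg] at hodd
    have := hle v
    obtain ⟨m, hm⟩ := hodd
    omega
  -- the three corners, as distinct vertices of the component
  have ne12 : Y₁' ≠ Y₂ := by
    rintro rfl; exact absurd (cornerFace_idx_unique D hY₁ hY₂) (by rw [add_right_inj]; decide)
  have ne14 : Y₁' ≠ Y₄ := by
    rintro rfl; exact absurd (cornerFace_idx_unique D hY₁ hY₄) (by rw [add_right_inj]; decide)
  have ne24 : Y₂ ≠ Y₄ := by
    rintro rfl; exact absurd (cornerFace_idx_unique D hY₂ hY₄) (by rw [add_right_inj]; decide)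
  let S : Finset C.supp := {⟨Y₁', h1⟩, ⟨Y₂, h2⟩, ⟨Y₄, h4⟩}
  have hS : S.card = 3 := by
    refine Finset.card_eq_three.2 ⟨⟨Y₁', h1⟩, ⟨Y₂, h2⟩, ⟨Y₄, h4⟩, ?_, ?_, ?_, rfl⟩
    · exact fun h => ne12 (congrArg Subtype.val h)
    · exact fun h => ne14 (congrArg Subtype.val h)
    · exact fun h => ne24 (congrArg Subtype.val h)
  have hSone : ∀ v ∈ S, C.toSimpleGraph.degree v = 1 := by
    intro v hv
    simp only [S, Finset.mem_insert, Finset.mem_singleton] at hv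
    apply hone
    rcases hv with rfl | rfl | rfl
    · exact ⟨r + 1, by rw [ne_eq, add_eq_left]; decide, hY₁⟩
    · exact ⟨r + 2, by rw [ne_eq, add_eq_left]; decide, hY₂⟩
    · exact ⟨r + 4, by rw [ne_eq, add_eq_left]; decide, hY₄⟩
  -- counting: Σ deg + 3 ≤ 2 #V …
  have hbound : ∑ v : C.supp, C.toSimpleGraph.degree v + 3 ≤ 2 * Fintype.card C.supp := by
    have hterm : ∀ v : C.supp, C.toSimpleGraph.degree v + (if v ∈ S then 1 else 0) ≤ 2 := by
      intro v
      split_ifs with hv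
      · rw [hSone v hv]
      · have := hle v; omega
    have hsum := Finset.sum_le_sum fun v (_ : v ∈ (Finset.univ : Finset C.supp)) => hterm v
    rw [Finset.sum_add_distrib, Finset.sum_const, smul_eq_mul, Finset.card_univ] at hsum
    have hind : ∑ v : C.supp, (if v ∈ S then 1 else 0) = 3 := by
      rw [Finset.sum_boole, Finset.filter_mem_eq_inter, Finset.univ_inter, hS]; rfl
    omega
  -- … but Σ deg = 2 #E ≥ 2 (#V - 1)
  have hhand := C.toSimpleGraph.sum_degrees_eq_twice_card_edges
  have hconn := (SimpleGraph.ConnectedComponent.connected_toSimpleGraph C).card_vert_le_card_edgeSet_add_one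
  rw [Nat.card_eq_fintype_card, Nat.card_eq_fintype_card, ← SimpleGraph.edgeFinset_card] at hconn
  have hconn' : Fintype.card C.supp ≤ #C.toSimpleGraph.edgeFinset + 1 := hconn
  have hhand' : ∑ v : C.supp, C.toSimpleGraph.degree v = 2 * #C.toSimpleGraph.edgeFinset := hhand
  omega

/-! ### LoopImage: the loop configuration of a colouring has its disorders at the four corners -/

/-- a bond with an endpoint in `G` is an edge of `H_G`. [cite: KhristoforovSmirnov2021, §1.2 (loop configurations, pp. 3–4)] -/
theorem mem_hBonds {u v : Site 2} (hadj : triGraph.Adj u v) (hG : u ∈ D.verts ∨ v ∈ D.verts) :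
    s(u, v) ∈ hBonds D := by
  classical
  have key : ∀ a b : Site 2, triGraph.Adj a b → (a ∈ D.verts ∨ b ∈ D.verts) → a ∈ D.verts ∪ triOuterBdry D.verts := by
    intro a b hab h
    by_cases ha : a ∈ D.verts
    · exact Finset.mem_union_left _ ha
    · have hb : b ∈ D.verts := h.resolve_left ha
      exact Finset.mem_union_right _ (Finset.mem_image.2 ⟨(b, a), mem_triBdryDarts.2 ⟨hb, ha, hab.symm⟩, rfl⟩)
  unfold hBonds
  refine Finset.mem_image.2 ⟨(u, v), Finset.mem_filter.2 ⟨Finset.mem_product.2 ⟨key u v hadj hG, key v u hadj.symm hG.symm⟩, hadj, hG⟩, rfl⟩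

/-- the sides of a face recorded in `ξ_{r,c}(σ)` are exactly its bicoloured sides. [cite: KhristoforovSmirnov2021, §1.2 (loop configurations, pp. 3–4)] -/
theorem mem_xiOf_iff (σ : SiteConfig (Site 2)) (r : Fin 5) (c : Bool) (F : HexVertex) (j : Fin 3) :
    s(faceVertex F (j + 1), faceVertex F (j + 2)) ∈ xiOf D σ r c ↔
      Bicol D σ r c (faceVertex F (j + 1)) (faceVertex F (j + 2)) := by
  classical
  unfold xiOf
  rw [Finset.mem_filter]
  constructor
  · rintro ⟨-, u, v, he, hb⟩
    rcases Sym2.eq_iff.1 he with ⟨h1, h2⟩ | ⟨h1, h2⟩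
    · rw [h1, h2]; exact hb
    · rw [h1, h2]; exact (bicol_comm D σ r c u v).1 hb
  · intro hb
    refine ⟨mem_hBonds D ?_ ?_, _, _, rfl, hb⟩
    · have e2 : j + 1 + 1 = j + 2 := by rw [add_assoc]; rfl
      rw [← e2, faceVertex_succ F (j + 1)]
      exact triGraph_adj_add_triDir _ _
    · rcases hb with ⟨h, -, -⟩ | ⟨h, -, -⟩ | ⟨h, -, -⟩
      · exact Or.inl h
      · exact Or.inl h
      · exact Or.inr h

/-- the `ξ_{r,c}(σ)`-degree of a face is its number of bicoloured sides. [cite: KhristoforovSmirnov2021, §1.2 (loop configurations, pp. 3–4)] -/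
theorem xiDeg_xiOf (σ : SiteConfig (Site 2)) (r : Fin 5) (c : Bool) (F : HexVertex) :
    xiDeg (xiOf D σ r c) F = bicolDeg D σ r c F := by
  classical
  unfold xiDeg bicolDeg
  congr 1
  exact Finset.filter_congr fun j _ => mem_xiOf_iff D σ r c F j

/-- **LoopImage holds for every domain**: `ξ_{r,c}(σ) ∈ W_Ω(y_{r+1}, …, y_{r+4})`. [cite: KhristoforovSmirnov2021, §1.2 (loop configurations, pp. 3–4)] -/
theorem loopImage_holds : LoopImage D := by
  classical
  intro σ r c
  unfold loopSpace
  rw [Finset.mem_filter, Finset.mem_powerset]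
  refine ⟨by unfold xiOf; exact Finset.filter_subset _ _, fun F _ => ?_⟩
  rw [xiDeg_xiOf]
  exact loopParity_holds D σ r c F


end Literature.Probability.Percolation.FivePoint
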